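import Summits.AtomisticToContinuum.BoseEinsteinCondensation.Theses.BECConjugateDomination
import Summits.AtomisticToContinuum.BoseEinsteinCondensation.Theses.BECHardSphereReduction
import HarnessLib

/-!
# Closure map of the crux `HardCoreExtension` (stmt-AtomisticToContinuum-11786) — the two-way edges
# (route `BECConjugateDomination`, line `domination-order-reversal`, continuation lead c9, 2026-08-17)

`HardCoreExtension := A → B` with `A` = dilute Dirichlet ground-state BEC for every potential of the
smooth class (repulsive finite range, finite, `C²` as `x ↦ v(|x|)`, edge condition `‖D²ṽ‖ ≤ Cₑ√ṽ`) and
`B = BoseEinsteinCondensation` (the sub-problem conjunct: the same for EVERY repulsive finite-range `v`).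
Leads c0–c8 landed the ONE-WAY reductions (`…DominationResidue`: `HardCoreDominates → HardSphereBEC →
HardCoreExtension`; `…NearMinTower`: `PeriodicBEC ∧ BoundaryTransferWeak → HardCoreExtension`). This file
records the CONVERSE edges, so that the ledger carries kernel-checked EQUIVALENCES rather than
implications (all pure logic over the route files; no analysis):

* `hardCoreExtension_iff_not_or`, `not_hardCoreExtension_iff` — classical normal form: the crux is
  `¬A ∨ B`, a disproof is `A ∧ ¬B`;
* `hardCoreExtension_iff_conjunct` — GIVEN ITS OWN ANTECEDENT `A` (which the route's chain
  `IMUChainGlue → SmoothPeriodicBEC → BoundaryTransferWeak` is built to deliver), the crux IS the conjunct;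
* `hardSphereBEC_of_conjunct`, `conjunct_iff_hardSphereBEC` — given `HardCoreDominates` (stmt-11884) the
  conjunct IS dilute hard-sphere BEC `HardSphereBEC` (stmt-11885);
* `hardSphereBEC_of_hardCoreExtension`, `hardCoreExtension_iff_hardSphereBEC` — hence, given `A` and
  stmt-11884, `HardCoreExtension ↔ HardSphereBEC`: modulo its antecedent the crux is exactly LSSY's open
  problem in the model case, and no weaker.

References: E. H. Lieb, R. Seiringer, J. P. Solovej, J. Yngvason, *The Mathematics of the Bose Gas and
its Condensation* (2005), §1.2 (1.19) and Ch. 5 p. 42 (BEC for genuinely interacting gases is open).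
-/

noncomputable section

namespace Summit.AtomisticToContinuum.BoseEinsteinCondensation.Cruxes.HardCoreExtension.ClosureMap

open Literature.MathematicalPhysics.QuantumManyBody.BoseGas
open scoped ENNReal
open Summit.AtomisticToContinuum.BoseEinsteinCondensation.Theses

/-! ## Normal form (classical logic) -/

/-- **The crux is `¬A ∨ B`.** `HardCoreExtension` unfolds to the implication `A → B`; classically this is
`¬A ∨ B`: either some smooth-class potential has NO dilute ground-state BEC, or the conjunct holds outright.
[cite: LSSY2005, Ch. 5 p. 42] -/
theorem hardCoreExtension_iff_not_or :
    BECConjugateDomination.HardCoreExtension ↔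
      (¬ (∀ v : ℝ → ℝ≥0∞, IsRepulsiveFiniteRange v → (∀ r, v r ≠ ⊤) →
          ContDiff ℝ 2 (fun x : Space => (v ‖x‖).toReal) →
          (∃ Cₑ : ℝ, ∀ x : Space, ‖iteratedFDeriv ℝ 2 (fun x : Space => (v ‖x‖).toReal) x‖ ≤
              Cₑ * Real.sqrt ((v ‖x‖).toReal)) →
          ∃ ρ₀ : ℝ, 0 < ρ₀ ∧ ∀ ρ : ℝ, 0 < ρ → ρ < ρ₀ → HasGroundStateBEC v ρ) ∨
        _root_.BoseEinsteinCondensation) :=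
  imp_iff_not_or

/-- **A disproof of the crux is `A ∧ ¬B`**: it must PROVE dilute ground-state BEC for every smooth-class
potential (thermodynamic-limit BEC for genuinely interacting soft potentials — open) AND refute the
conjunct. [cite: LSSY2005, Ch. 5 p. 42] -/
theorem not_hardCoreExtension_iff :
    ¬ BECConjugateDomination.HardCoreExtension ↔
      ((∀ v : ℝ → ℝ≥0∞, IsRepulsiveFiniteRange v → (∀ r, v r ≠ ⊤) →
          ContDiff ℝ 2 (fun x : Space => (v ‖x‖).toReal) →
          (∃ Cₑ : ℝ, ∀ x : Space, ‖iteratedFDeriv ℝ 2 (fun x : Space => (v ‖x‖).toReal) x‖ ≤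
              Cₑ * Real.sqrt ((v ‖x‖).toReal)) →
          ∃ ρ₀ : ℝ, 0 < ρ₀ ∧ ∀ ρ : ℝ, 0 < ρ → ρ < ρ₀ → HasGroundStateBEC v ρ) ∧
        ¬ _root_.BoseEinsteinCondensation) :=
  Classical.not_imp

/-- **The conjunct implies the crux** (the crux is formally WEAKER than the sub-problem: `B → (A → B)`).
[cite: LSSY2005, Ch. 5 p. 42] -/
theorem hardCoreExtension_of_conjunct (hB : _root_.BoseEinsteinCondensation) :
    BECConjugateDomination.HardCoreExtension :=
  fun _ => hB

/-! ## Given its own antecedent the crux is the conjunct -/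

/-- **Given `A`, `HardCoreExtension ↔ BoseEinsteinCondensation`.** The route `BECConjugateDomination` is
built to deliver `A` (`IMUChainGlue → SmoothPeriodicBEC`, then `BoundaryTransferWeak` per potential); once it
does, what remains of the crux is the whole conjunct, for every repulsive finite-range potential — hard
cores, shells, steps and kinks included — and nothing less. [cite: LSSY2005, §1.2 (1.19) and Ch. 5 p. 42] -/
theorem hardCoreExtension_iff_conjunct
    (hA : ∀ v : ℝ → ℝ≥0∞, IsRepulsiveFiniteRange v → (∀ r, v r ≠ ⊤) →
      ContDiff ℝ 2 (fun x : Space => (v ‖x‖).toReal) →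
      (∃ Cₑ : ℝ, ∀ x : Space, ‖iteratedFDeriv ℝ 2 (fun x : Space => (v ‖x‖).toReal) x‖ ≤
          Cₑ * Real.sqrt ((v ‖x‖).toReal)) →
      ∃ ρ₀ : ℝ, 0 < ρ₀ ∧ ∀ ρ : ℝ, 0 < ρ → ρ < ρ₀ → HasGroundStateBEC v ρ) :
    BECConjugateDomination.HardCoreExtension ↔ _root_.BoseEinsteinCondensation :=
  ⟨fun h => h hA, fun hB _ => hB⟩

/-! ## Given `HardCoreDominates` (stmt-11884) the conjunct is dilute hard-sphere BEC (stmt-11885) -/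

/-- The hard sphere `⊤·1_{(-∞, a]}` (spelling of route `BECHardSphereReduction`) is an admissible pair
potential: measurable (indicator of a measurable set) and of finite range `a`. [cite: LSSY2005, Ch. 2 after (2.1)] -/
theorem isRepulsiveFiniteRange_indicator_Iic_top (a : ℝ) :
    IsRepulsiveFiniteRange (Set.indicator (Set.Iic a) (fun _ : ℝ => (⊤ : ℝ≥0∞))) :=
  ⟨measurable_const.indicator measurableSet_Iic,
    a, fun r hr => Set.indicator_of_notMem (fun hm : r ∈ Set.Iic a => (not_le.2 hr) hm) _⟩

/-- **The conjunct contains dilute hard-sphere BEC**: `BoseEinsteinCondensation → HardSphereBEC`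
(stmt-11885 is the conjunct restricted to the hard-sphere family). [cite: LSSY2005, Ch. 5 p. 42] -/
theorem hardSphereBEC_of_conjunct (hB : _root_.BoseEinsteinCondensation) :
    BECHardSphereReduction.HardSphereBEC :=
  fun a _ => hB _ (isRepulsiveFiniteRange_indicator_Iic_top a)

/-- **Given `HardCoreDominates` (stmt-11884), `BoseEinsteinCondensation ↔ HardSphereBEC`** (`←` is the
gate-written deciding theorem `BECHardSphereReduction.closes`; `→` is restriction to hard spheres).
[cite: LSSY2005, Ch. 5 p. 42] -/
theorem conjunct_iff_hardSphereBEC (hD : BECHardSphereReduction.HardCoreDominates) :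
    _root_.BoseEinsteinCondensation ↔ BECHardSphereReduction.HardSphereBEC :=
  ⟨hardSphereBEC_of_conjunct, BECHardSphereReduction.closes hD⟩

/-! ## Hence, modulo `A` (and stmt-11884), the crux is exactly dilute hard-sphere BEC -/

/-- **`HardCoreExtension` and its antecedent give dilute hard-sphere BEC (stmt-11885)**: the crux, once
the route supplies `A`, is at least LSSY's open problem in the model case. [cite: LSSY2005, Ch. 5 p. 42] -/
theorem hardSphereBEC_of_hardCoreExtension (h : BECConjugateDomination.HardCoreExtension)
    (hA : ∀ v : ℝ → ℝ≥0∞, IsRepulsiveFiniteRange v → (∀ r, v r ≠ ⊤) →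
      ContDiff ℝ 2 (fun x : Space => (v ‖x‖).toReal) →
      (∃ Cₑ : ℝ, ∀ x : Space, ‖iteratedFDeriv ℝ 2 (fun x : Space => (v ‖x‖).toReal) x‖ ≤
          Cₑ * Real.sqrt ((v ‖x‖).toReal)) →
      ∃ ρ₀ : ℝ, 0 < ρ₀ ∧ ∀ ρ : ℝ, 0 < ρ → ρ < ρ₀ → HasGroundStateBEC v ρ) :
    BECHardSphereReduction.HardSphereBEC :=
  hardSphereBEC_of_conjunct (h hA)

/-- **Given `A` and `HardCoreDominates` (stmt-11884): `HardCoreExtension ↔ HardSphereBEC` (stmt-11885).**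
Together with `hardCoreExtension_iff_conjunct` this is the closure map of the crux: modulo its own
antecedent it is the conjunct, and modulo the pointwise-order comparison stmt-11884 the conjunct is dilute
hard-sphere BEC; in particular no completion of stmt-11786 can be cheaper than stmt-11885.
[cite: LSSY2005, Ch. 5 p. 42] -/
theorem hardCoreExtension_iff_hardSphereBEC
    (hA : ∀ v : ℝ → ℝ≥0∞, IsRepulsiveFiniteRange v → (∀ r, v r ≠ ⊤) →
      ContDiff ℝ 2 (fun x : Space => (v ‖x‖).toReal) →
      (∃ Cₑ : ℝ, ∀ x : Space, ‖iteratedFDeriv ℝ 2 (fun x : Space => (v ‖x‖).toReal) x‖ ≤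
          Cₑ * Real.sqrt ((v ‖x‖).toReal)) →
      ∃ ρ₀ : ℝ, 0 < ρ₀ ∧ ∀ ρ : ℝ, 0 < ρ → ρ < ρ₀ → HasGroundStateBEC v ρ)
    (hD : BECHardSphereReduction.HardCoreDominates) :
    BECConjugateDomination.HardCoreExtension ↔ BECHardSphereReduction.HardSphereBEC :=
  (hardCoreExtension_iff_conjunct hA).trans (conjunct_iff_hardSphereBEC hD)

/-! ## Registered form (one-line `Prop`, stub `stub_closureMap` of stmt-11786: the closure map as ONE implication) -/

/-- **Closure map, registered form**: `A → HardCoreDominates → (HardCoreExtension ↔ HardSphereBEC)` —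
modulo its own antecedent and the pointwise-order comparison stmt-11884, the crux stmt-11786 is exactly
dilute hard-sphere BEC stmt-11885 (LSSY's open problem in the model case). [cite: LSSY2005, Ch. 5 p. 42] -/
theorem stub_closureMap :
    (∀ v : ℝ → ℝ≥0∞, IsRepulsiveFiniteRange v → (∀ r, v r ≠ ⊤) → ContDiff ℝ 2 (fun x : Space => (v ‖x‖).toReal) → (∃ Cₑ : ℝ, ∀ x : Space, ‖iteratedFDeriv ℝ 2 (fun x : Space => (v ‖x‖).toReal) x‖ ≤ Cₑ * Real.sqrt ((v ‖x‖).toReal)) → ∃ ρ₀ : ℝ, 0 < ρ₀ ∧ ∀ ρ : ℝ, 0 < ρ → ρ < ρ₀ → HasGroundStateBEC v ρ) → BECHardSphereReduction.HardCoreDominates → (BECConjugateDomination.HardCoreExtension ↔ BECHardSphereReduction.HardSphereBEC) :=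
  fun hA hD => hardCoreExtension_iff_hardSphereBEC hA hD

end Summit.AtomisticToContinuum.BoseEinsteinCondensation.Cruxes.HardCoreExtension.ClosureMap

end
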